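import Summits.QuantumFields.BalabanUV.T4Continuum.Support.NE7BalabanSoftOperator
import Summits.QuantumFields.BalabanUV.T4Continuum.Support.NE7ConstrainedGreenIdentity
import Summits.QuantumFields.BalabanUV.T4Continuum.Support.NE3CurlOfGaugeDir
import HarnessLib

/-!
# NE7ConstrainedGreenRowsSplit — THE SUP ROWS OF BAŁABAN's CONSTRAINED PROPAGATOR `C = G − G·Qbar*·(QbarGQbar*)⁻¹·Qbar·G` ON OUR CARRIER SPLIT INTO PRINT's SEPARATE ROWS:
# the sup-VALUE row `A₀` and sup-CURL row `A₁` of `G` ([B9] Thm 3.3 (3.42)₁,₂ SHAPE), the sup row `A_E` of `(QbarGQbar*)⁻¹` ([B9] (3.49) SHAPE) and the `ℓ^∞ → ℓ^∞` bounds `c_Q`,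
# `c_Q*` of the average and its adjoint give the END's rows (C) with `K₀ = A₀(1 + c_Q*·A_E·c_Q·A₀)`, `K = A₁(1 + c_Q*·A_E·c_Q·A₀)` — lineage #2's flat
# `rankOneSourceSolver_of_threeBounds` pattern at a curved background, for ARBITRARY linear maps on the skew torus 1-forms (file 129 of the curved (APE), F200)

Cell `pub-balaban`, rung (B)+1 sub-cell t4, lineage `b2b-balaban-t4-ne7-p1` (CRUX PROVER NE7 #1 = OWNER of row NE7), generation 85; memo
`t4/b2b-balaban-t4-ne7-p1-g85/LAGRANGE-CARRIER.md` §7(i).  Over F192 `NE7BalabanSoftOperator` (`skewForms`, `extF`), (140) `NE7ConstrainedGreenIdentity.constrainedGreen_apply`,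
`NE3CurlOfGaugeDir.curlAt_sub` BY NAME.
WHY.  The ENDs F194∕F197∕F199 display the rows (C) of the constrained propagator as a whole; [B9] prints them separately — Thm 3.3 for `G(U) = Δ_a(U)⁻¹` (entries `|GJ|`, `|∇_U GJ|`
of (3.42)), (3.49) for `(QGQ*)⁻¹`, and the averaging operators are `ℓ^∞`-contractions up to constants ([B7] (120), straight double-bar average).  THIS file is the bookkeeping
`C h = G h − G(Qbar*(Dinv(Qbar(G h))))` in sup norms, so that the successor ∕ lit-balaban can supply the rows ONE OPERATOR AT A TIME.
WHAT ([folklore]; 0 def, 0 sorry).  §1 `norm_extF_sub`, `curlAt_extF_sub`; §2 **`valueRow_constrainedGreen`** (`K₀ = A₀ + A₀·c_Q*·A_E·c_Q·A₀`), **`curlRow_constrainedGreen`**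
(`K = A₁ + A₁·c_Q*·A_E·c_Q·A₀`) for arbitrary `G`, `Q`, `Qt`, `Dinv` on the skew torus 1-forms with the five displayed sup letters.
HONEST FRAMING (page 1): triangle inequalities; NO estimate of Bałaban's; the five letters are DISPLAYED HYPOTHESES (print's Thm 3.3 ∕ (3.49) ∕ [B7] (120) SHAPES on our carrier, NOT
proved here); (KL-B) at curved `W` NOT proved; (APE) on curved data NOT proved; NOT ONE-STEP, NOT NE7; spine 0∕9; finite T⁴ rung (B)+1 — NOT infinite volume, NOT mass gap, NOT
`BetaPertH`, NOT Clay.  Continuum YM on T⁴ ⇐ BetaPertH ∧ nine spine estimates (0/9 proved); BetaPertH ⇐ (D1) ∧ (D4) ∧ CAP+tail; G-an2-4 gates asym, D1 and NE2/3/4.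
-/

set_option autoImplicit false

open scoped BigOperators Matrix Matrix.Norms.L2Operator
open Finset

namespace Summit.QuantumFields.BalabanUV.T4Continuum.NE7ConstrainedGreenRowsSplit

open Literature.MathematicalPhysics.QuantumFieldTheory.Balaban1983to89
open B7Prop1Explicit B7Prop2Explicit UnitaryModel
open T4AveragingDeficitWall (curlAt)
open NE3HilbertSchmidtTorus
open NE3CurlOfGaugeDir (curlAt_sub)
open NE7ConstrainedGreenIdentity (constrainedGreen constrainedGreen_apply)
open NE7BalabanSoftOperator (skewForms)

noncomputable section

variable {d : ℕ} {n : Type*} [Fintype n] [DecidableEq n]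

/-! ## §1 Differences through the chart -/

omit [Fintype n] [DecidableEq n] in
/-- The extension of a difference of skew torus 1-forms, bondwise. [folklore] -/
theorem extF_coe_sub {P : ℕ} [NeZero P] (a b : skewForms d n P) (y : Site d) (κ : Fin d) :
    extF P ((a - b : skewForms d n P) : Form d n P) y κ = extF P (a : Form d n P) y κ - extF P (b : Form d n P) y κ := by
  simp only [Submodule.coe_sub, extF_sub]

/-- The dressed curl of the extension of a difference. [folklore] -/
theorem curlAt_extF_coe_sub (W : Site d → Fin d → (Matrix n n ℂ)ˣ) {P : ℕ} [NeZero P] (a b : skewForms d n P) (z : Site d) (μ ν : Fin d) :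
    curlAt W (extF P ((a - b : skewForms d n P) : Form d n P)) z μ ν
      = curlAt W (extF P (a : Form d n P)) z μ ν - curlAt W (extF P (b : Form d n P)) z μ ν := by
  rw [← curlAt_sub]
  rfl

/-! ## §2 The rows of `C = G − G Qt Dinv Q G` from the rows of its factors -/

section Rows

variable {P N : ℕ} [NeZero P] [NeZero N]
  (G : skewForms d n P →ₗ[ℝ] skewForms d n P) (Q : skewForms d n P →ₗ[ℝ] skewForms d n N) (Qt : skewForms d n N →ₗ[ℝ] skewForms d n P)
  (Dinv : skewForms d n N →ₗ[ℝ] skewForms d n N)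
  {A₀ A₁ cQ cQt AE : ℝ}
  (hG0 : ∀ h : skewForms d n P, ∀ g : ℝ, (∀ (y : Site d) (κ : Fin d), ‖extF P (h : Form d n P) y κ‖ ≤ g) →
    ∀ (y : Site d) (κ : Fin d), ‖extF P ((G h : skewForms d n P) : Form d n P) y κ‖ ≤ A₀ * g)
  (hQ : ∀ b : skewForms d n P, ∀ g : ℝ, (∀ (y : Site d) (κ : Fin d), ‖extF P (b : Form d n P) y κ‖ ≤ g) →
    ∀ (y : Site d) (κ : Fin d), ‖extF N ((Q b : skewForms d n N) : Form d n N) y κ‖ ≤ cQ * g)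
  (hQt : ∀ m : skewForms d n N, ∀ g : ℝ, (∀ (y : Site d) (κ : Fin d), ‖extF N (m : Form d n N) y κ‖ ≤ g) →
    ∀ (y : Site d) (κ : Fin d), ‖extF P ((Qt m : skewForms d n P) : Form d n P) y κ‖ ≤ cQt * g)
  (hE : ∀ f : skewForms d n N, ∀ g : ℝ, (∀ (y : Site d) (κ : Fin d), ‖extF N (f : Form d n N) y κ‖ ≤ g) →
    ∀ (y : Site d) (κ : Fin d), ‖extF N ((Dinv f : skewForms d n N) : Form d n N) y κ‖ ≤ AE * g)

include hG0 hQ hQt hE in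
/-- **THE VALUE ROW OF `C`**: `‖extF (C h)‖_∞ ≤ (A₀ + A₀·c_Q*·A_E·c_Q·A₀)·‖extF h‖_∞` from the value row `A₀` of `G`, the sup row `A_E` of `Dinv` and the `ℓ^∞` bounds of `Q`, `Qt`.
[folklore] -/
theorem valueRow_constrainedGreen (h : skewForms d n P) {g : ℝ} (hh : ∀ (y : Site d) (κ : Fin d), ‖extF P (h : Form d n P) y κ‖ ≤ g) (y : Site d) (κ : Fin d) :
    ‖extF P ((constrainedGreen G Q Qt Dinv h : skewForms d n P) : Form d n P) y κ‖ ≤ (A₀ + A₀ * cQt * AE * cQ * A₀) * g := by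
  have h1 := hG0 h g hh
  have h2 := hQ _ _ h1
  have h3 := hE _ _ h2
  have h4 := hQt _ _ h3
  have h5 := hG0 _ _ h4
  rw [constrainedGreen_apply, extF_coe_sub]
  calc ‖extF P ((G h : skewForms d n P) : Form d n P) y κ - extF P ((G (Qt (Dinv (Q (G h)))) : skewForms d n P) : Form d n P) y κ‖
      ≤ ‖extF P ((G h : skewForms d n P) : Form d n P) y κ‖ + ‖extF P ((G (Qt (Dinv (Q (G h)))) : skewForms d n P) : Form d n P) y κ‖ := norm_sub_le _ _
    _ ≤ A₀ * g + A₀ * (cQt * (AE * (cQ * (A₀ * g)))) := add_le_add (h1 y κ) (h5 y κ)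
    _ = (A₀ + A₀ * cQt * AE * cQ * A₀) * g := by ring

include hG0 hQ hQt hE in
/-- **THE CURL ROW OF `C`**: `‖curl_W (extF (C h))‖ ≤ (A₁ + A₁·c_Q*·A_E·c_Q·A₀)·‖extF h‖_∞` from the curl row `A₁` and the value row `A₀` of `G`, the sup row `A_E` of `Dinv` and the `ℓ^∞`
bounds of `Q`, `Qt`. [folklore] -/
theorem curlRow_constrainedGreen (W : Site d → Fin d → (Matrix n n ℂ)ˣ)
    (hG1 : ∀ h : skewForms d n P, ∀ g : ℝ, (∀ (y : Site d) (κ : Fin d), ‖extF P (h : Form d n P) y κ‖ ≤ g) →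
      ∀ (z : Site d) (μ' ν' : Fin d), μ' ≠ ν' → ‖curlAt W (extF P ((G h : skewForms d n P) : Form d n P)) z μ' ν'‖ ≤ A₁ * g)
    (h : skewForms d n P) {g : ℝ} (hh : ∀ (y : Site d) (κ : Fin d), ‖extF P (h : Form d n P) y κ‖ ≤ g) (z : Site d) (μ' ν' : Fin d) (hne : μ' ≠ ν') :
    ‖curlAt W (extF P ((constrainedGreen G Q Qt Dinv h : skewForms d n P) : Form d n P)) z μ' ν'‖ ≤ (A₁ + A₁ * cQt * AE * cQ * A₀) * g := by
  have h1 := hG0 h g hh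
  have h2 := hQ _ _ h1
  have h3 := hE _ _ h2
  have h4 := hQt _ _ h3
  have hc1 := hG1 h g hh z μ' ν' hne
  have hc5 := hG1 _ _ h4 z μ' ν' hne
  rw [constrainedGreen_apply, curlAt_extF_coe_sub]
  calc ‖curlAt W (extF P ((G h : skewForms d n P) : Form d n P)) z μ' ν' - curlAt W (extF P ((G (Qt (Dinv (Q (G h)))) : skewForms d n P) : Form d n P)) z μ' ν'‖
      ≤ ‖curlAt W (extF P ((G h : skewForms d n P) : Form d n P)) z μ' ν'‖ + ‖curlAt W (extF P ((G (Qt (Dinv (Q (G h)))) : skewForms d n P) : Form d n P)) z μ' ν'‖ :=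
        norm_sub_le _ _
    _ ≤ A₁ * g + A₁ * (cQt * (AE * (cQ * (A₀ * g)))) := add_le_add hc1 hc5
    _ = (A₁ + A₁ * cQt * AE * cQ * A₀) * g := by ring

end Rows

end

end Summit.QuantumFields.BalabanUV.T4Continuum.NE7ConstrainedGreenRowsSplit
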